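import Summits.QuantumFields.YangMills.Theorems.VirialFluxGapResidualTransversality
import Summits.QuantumFields.YangMills.Theorems.VirialFluxGapRingTreeGaugeTransfer
import HarnessLib

/-!
# Orbit separation at a sign-class twist-eater on the tree-gauged space: `D_fix(k·Q_s, Q_s) ≥ 2·min(‖q k − 1‖², ‖q k + 1‖²)`
# (layer (B2), first step of `hslice`, of the DIRECT Laplace road to ⟨stmt-QuantumFields-24204⟩ `VirialFluxGap.SharpTwistedLaplace`)

Helper module (free-hands work of width seat ym-line-sfw-p2-w2 g49, cell ym-idea-1).  On `X_fix(L)` with the squared chordal distance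
`D(ι x, ι x')` (✓`VirialFluxGapRingTreeGaugeTransfer`) and the residual action of ✓`VirialFluxGapFixGaugeAction`, at the sign-class representative
`Q_s = (combFlat W_s|off, (combFlat W_s)_j, λ·C₀)`, `W_s(k) = centreElem(s_k)·(N₀ if z_k else 1)`:
* `norm_su2Quat_conj_centre_mul_sub` — `‖q(k(εN)k⁻¹) − q(εN)‖ = ‖q(kNk⁻¹) − q(N)‖` for central signs `ε = centreElem b`;
* `not_treeEdge_wrap` — the wrapping link `((−1,−1,−1), k₀)` is off the comb tree (`L ≥ 2`);
* ★ `two_mul_min_le_ringDistSq_fix_orbit` — for `z k₀ = true` and every `k ∈ SU(2)`: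
  `2·min(‖q k − 1‖², ‖q k + 1‖²) ≤ D(ι(k·Q_s), ι Q_s)` — the residual orbit map at `Q_s` separates `SU(2)/{±1}` with an `L`-INDEPENDENT constant
  (one wrapping link of slice `0` carries `±N₀`, the seam at the origin carries `C₀`; ✓`two_mul_min_le_conj_sub_sq_add`).
Everything is PROVED; no definitions, no named facts.  HONEST FRAMING: bookkeeping; ⟨24204⟩, ⟨24319⟩ and every rung stay OPEN; the Yang–Mills mass gap
(Clay) is NOT touched; no summit is proved by a line.
-/

noncomputable section

open scoped Quaternion Matrix BigOperators
open Literature.MathematicalPhysics.QuantumFieldTheory hiding SU2 su2Quat_mul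
open Literature.MathematicalPhysics.QuantumLattice
open Literature.MathematicalPhysics.QuantumFieldTheory.Balaban1983to89.T4HaarSU2Translate (su2Quat_mul)
open Summit.QuantumFields.YangMills.Theorems.FemtoTransferGap
open Summit.QuantumFields.YangMills.Theorems.FemtoTransferGap.TT
open Summit.QuantumFields.YangMills.Theorems.FemtoTransferGap.TwoLattice
open Summit.QuantumFields.YangMills.Theorems.FemtoTransferGap.TwoLattice.Flat
open Summit.QuantumFields.YangMills.Theorems.FemtoTransferGap.TwoLattice.ConstTube (re_trace_su2Rep_mul_inv_eq_norm)
open Summit.QuantumFields.YangMills.Theorems.ToronValleyVolume.Lojasiewicz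
open Summit.QuantumFields.YangMills.Theorems.VirialFluxGap.RingDeficit

namespace Summit.QuantumFields.YangMills.Theorems.QuantitativeLaplace

variable {L : ℕ} [NeZero L]

/-! ## §1 Central signs drop out of conjugation distances -/

omit [NeZero L] in
/-- `‖q(k (ε N) k⁻¹) − q(ε N)‖ = ‖q(k N k⁻¹) − q N‖` for a central sign `ε = centreElem b`. [folklore] -/
theorem norm_su2Quat_conj_centre_mul_sub (k N : SU2) (b : Bool) :
    ‖su2Quat (k * (centreElem b * N) * k⁻¹) - su2Quat (centreElem b * N)‖ = ‖su2Quat (k * N * k⁻¹) - su2Quat N‖ := by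
  have hε : su2Quat (centreElem b) = if b then (-1 : ℍ) else 1 := su2Quat_centreElem b
  have e : su2Quat (k * (centreElem b * N) * k⁻¹) - su2Quat (centreElem b * N) =
      su2Quat (centreElem b) * (su2Quat (k * N * k⁻¹) - su2Quat N) := by
    rw [su2Quat_mul, su2Quat_mul, su2Quat_mul, su2Quat_mul, su2Quat_mul, hε]
    split_ifs <;> noncomm_ring
  rw [e, norm_mul, hε]
  split_ifs <;> simp

/-! ## §2 A wrapping link is off the comb tree -/

omit [NeZero L] in
/-- For `L ≥ 2` the wrapping link at the corner site `(−1,−1,−1)` in any direction is NOT a tree edge. [folklore] -/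
theorem not_treeEdge_wrap (hL : 2 ≤ L) (k₀ : Fin 3) : ¬ treeEdge (((fun _ : Fin 3 => (-1 : ZMod L)), k₀) : Edge 3 L) = true := by
  haveI : Fact (1 < L) := ⟨hL⟩
  have hne : (-1 : ZMod L) ≠ 0 := by
    rw [Ne, neg_eq_zero]; exact one_ne_zero
  rw [treeEdge_iff]
  rintro (⟨-, h⟩ | ⟨-, h, -⟩ | ⟨-, h, -, -⟩)
  · exact h rfl
  · exact hne h
  · exact hne h

/-! ## §3 Orbit separation at `Q_s` -/

/-- ★ **Orbit separation at a sign-class twist-eater on `X_fix`**: for `L ≥ 2`, `z k₀ = true`, `λ 0 = 1` and every `k ∈ SU(2)`,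
`2·min(‖q k − 1‖², ‖q k + 1‖²) ≤ D(ι(k·Q_s), ι Q_s)`. [folklore] -/
theorem two_mul_min_le_ringDistSq_fix_orbit (hL : 2 ≤ L) (z s : Fin 3 → Bool) {k₀ : Fin 3} (hk₀ : z k₀ = true)
    {lam : Site 3 L → SU2} (hlam0 : lam 0 = 1) {N₀ C₀ : SU2} (hN : (su2Quat N₀).re = 0) (hC : (su2Quat C₀).re = 0)
    (hNC : (su2Quat N₀).imI * (su2Quat C₀).imI + (su2Quat N₀).imJ * (su2Quat C₀).imJ + (su2Quat N₀).imK * (su2Quat C₀).imK = 0)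
    (k : SU2) :
    2 * min (‖su2Quat k - 1‖ ^ 2) (‖su2Quat k + 1‖ ^ 2) ≤
      (∑ i : Fin (2 * L - 1 + 1), (6 * (L : ℝ) ^ 3 - timeCoupling su2Rep
        ((Fin.cons (glue fun i : OffIdx L => k * combFlat (fun a => centreElem (s a) * (if z a then N₀ else 1)) i.1 * k⁻¹)
            (fun _ : Fin (2 * L - 1) => gaugeTransform (fun _ : Site 3 L => k)
              (combFlat fun a => centreElem (s a) * (if z a then N₀ else 1))) : Fin (2 * L - 1 + 1) → GaugeConfig 3 L SU2) i)
        ((Fin.cons (glue fun i : OffIdx L => combFlat (fun a => centreElem (s a) * (if z a then N₀ else 1)) i.1)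
            (fun _ : Fin (2 * L - 1) => combFlat fun a => centreElem (s a) * (if z a then N₀ else 1)) :
              Fin (2 * L - 1 + 1) → GaugeConfig 3 L SU2) i))) +
        ∑ x : Site 3 L, (2 - ((su2Rep ((k * (lam x * C₀) * k⁻¹) * (lam x * C₀)⁻¹)).trace).re) := by
  set W : Fin 3 → SU2 := fun a => centreElem (s a) * (if z a then N₀ else 1) with hW
  set A : Fin (2 * L - 1 + 1) → GaugeConfig 3 L SU2 :=
    Fin.cons (glue fun i : OffIdx L => k * combFlat W i.1 * k⁻¹)
      (fun _ : Fin (2 * L - 1) => gaugeTransform (fun _ : Site 3 L => k) (combFlat W)) with hA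
  set B : Fin (2 * L - 1 + 1) → GaugeConfig 3 L SU2 :=
    Fin.cons (glue fun i : OffIdx L => combFlat W i.1) (fun _ : Fin (2 * L - 1) => combFlat W) with hB
  set e₀ : Edge 3 L := ((fun _ : Fin 3 => (-1 : ZMod L)), k₀) with he₀
  have hoff : ¬ treeEdge e₀ = true := not_treeEdge_wrap hL k₀
  have hWe : combFlat W e₀ = centreElem (s k₀) * N₀ := by
    rw [combFlat_apply, if_pos (show e₀.1 e₀.2 = -1 from rfl)]
    show W k₀ = _
    simp only [hW, hk₀]
    rfl
  have hA0 : A 0 e₀ = k * (centreElem (s k₀) * N₀) * k⁻¹ := by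
    rw [hA, Fin.cons_zero, glue_apply_of_not_tree _ hoff, hWe]
  have hB0 : B 0 e₀ = centreElem (s k₀) * N₀ := by
    rw [hB, Fin.cons_zero, glue_apply_of_not_tree _ hoff, hWe]
  -- the slice sum dominates the single wrapping link of slice 0
  have h1 : ‖su2Quat (k * N₀ * k⁻¹) - su2Quat N₀‖ ^ 2 ≤
      ∑ i : Fin (2 * L - 1 + 1), (6 * (L : ℝ) ^ 3 - timeCoupling su2Rep (A i) (B i)) := by
    have hterm : ‖su2Quat (k * N₀ * k⁻¹) - su2Quat N₀‖ ^ 2 ≤ 6 * (L : ℝ) ^ 3 - timeCoupling su2Rep (A 0) (B 0) := by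
      have h := norm_sq_le_timeCoupling_deficit (A 0) (B 0) e₀
      rwa [hA0, hB0, norm_su2Quat_conj_centre_mul_sub] at h
    refine hterm.trans ?_
    exact Finset.single_le_sum (f := fun i => 6 * (L : ℝ) ^ 3 - timeCoupling su2Rep (A i) (B i))
      (fun i _ => by rw [timeCoupling_deficit_eq]; positivity) (Finset.mem_univ 0)
  -- the seam sum dominates the origin
  have h2 : ‖su2Quat (k * C₀ * k⁻¹) - su2Quat C₀‖ ^ 2 ≤
      ∑ x : Site 3 L, (2 - ((su2Rep ((k * (lam x * C₀) * k⁻¹) * (lam x * C₀)⁻¹)).trace).re) := by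
    have hterm : ‖su2Quat (k * C₀ * k⁻¹) - su2Quat C₀‖ ^ 2 =
        2 - ((su2Rep ((k * (lam 0 * C₀) * k⁻¹) * (lam 0 * C₀)⁻¹)).trace).re := by
      rw [hlam0, one_mul, re_trace_su2Rep_mul_inv_eq_norm]; ring
    rw [hterm]
    exact Finset.single_le_sum (f := fun x => 2 - ((su2Rep ((k * (lam x * C₀) * k⁻¹) * (lam x * C₀)⁻¹)).trace).re)
      (fun x _ => by rw [re_trace_su2Rep_mul_inv_eq_norm]; nlinarith [norm_nonneg (su2Quat (k * (lam x * C₀) * k⁻¹) - su2Quat (lam x * C₀))])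
      (Finset.mem_univ 0)
  have h3 := two_mul_min_le_conj_sub_sq_add k hN hC hNC
  linarith

end Summit.QuantumFields.YangMills.Theorems.QuantitativeLaplace
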